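import Summits.QuantumFields.BalabanUV.Beta.GAN24.EffectiveFormInsertionLaw

/-!
# `BalabanUV.Beta.GAN24.EffectiveFormSecondInsertionLaw` — binder row G-an2-4 ∕ (CONV-C), routes R6 × R7 in NE2's operator currency, PART 121: THE EFFECTIVE FORM's SECOND
# u-DERIVATIVE ON THE UNIT LATTICE.  Along a background family `t ↦ c_k(t)` of unit-lattice block propagators, `∂_t²(c_k⁻¹) = 2c_k⁻¹ċ_kc_k⁻¹ċ_kc_k⁻¹ − c_k⁻¹c̈_kc_k⁻¹`; both pieces
# inherit the one-step rates of `c_k`, `ċ_k`, `c̈_k` under the UB letter (`‖G′X′G′X′G′ − GXGXG‖ ≤ 3B²m²‖G′ − G‖ + 2B³m‖X′ − X‖`, five-factor Leibniz); on BAŁABAN's (1.18)-averaged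
# tower with the first-order model (`ċ_k`, `c̈_k` = the unit-lattice images of `𝒢P𝒢` and `2·𝒢P𝒢P𝒢`, PART 115 orders 1 and 2; UB = `uniformCoercive_unitCovB`) the second u-derivative
# tower of the effective form CONVERGES at rate `L^{−k}` — UNCONDITIONAL («the smeared SECOND B-derivative `V_{bb}` of `CᵀΔ^{(k)}C`» class of the row text, caricature)
# (unit b2b-balaban-gan24-p3, gen 51; v1)

NOT IN PRINT; OUR PROOF ([folklore] Leibniz algebra in the `ℓ²`-operator norm; PART 118 `EffectiveFormInsertionLaw` (`opNorm_inv_sub_inv_le`, `effIns_tendsto_of_geom`, `opNorm_avgTow_le`,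
`opNorm_avgTow_step_le_of_law`, `isUnit_det_unitCovB_and_opNorm_inv_le`), PART 115 `InsertionChainLaw.oneStepAveragedLaw_insertion` (orders 1, 2), NE2's `freeTowerLaws_balaban`,
`perturbationLaws_firstOrder`, `oneStepAveragedLaw_QB` BY NAME).
HONEST FRAMING (cell contract, verbatim): «discharging `BetaPertH` makes Bałaban's UV stability UNCONDITIONAL — a real constructive-QFT result; it is NOT the continuum limit and NOT
the Clay problem.»  HONEST DEPENDENCY (verbatim): «continuum YM on T⁴ ⇐ BetaPertH ∧ nine spine estimates (0/9 proved); BetaPertH ⇐ (D1) ∧ (D4) ∧ CAP+tail; G-an2-4 gates asym, D1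
and NE2/3/4.»

WHAT THIS FILE PROVES (0 sorry, 0 `def`, nothing cited; `ι` a finite index type, complex matrices, `ℓ²`-operator norm):
* §1 `opNorm_mul₃_le` ∕ `opNorm_mul₅_le` (norms of products against letter bounds), `quint_sub_quint_eq` (five-factor Leibniz, EXACT, two middles `X, Y`), **`opNorm_quint_sub_le`**
  (`‖G′X′G′Y′G′ − GXGYG‖ ≤ 3B²m²e + B³m(e′ + e″)`), **`opNorm_effIns2_sub_le`** (`G = c⁻¹`: `≤ 3B⁴m²‖c′ − c‖ + B³m(‖X′ − X‖ + ‖Y′ − Y‖)`).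
* §2 towers (`c_k`, `X_k`, `Y_k`): **`opNorm_effIns2_step_le`**, `norm_effIns2_entry_step_le`, **`effIns2_tendsto_of_geom`** (rate `(3B⁴m²C + B³m(C′ + C″))·ρ^k/(1 − ρ)`), and the COMBINATION
  **`secondDerivative_tendsto`**: `2·(A_k − B_k)` converges with rate `2(R_A + R_B)` when `A_k`, `B_k` do (`∂_t²(c⁻¹)|₀ = 2·(c⁻¹ċc⁻¹ċc⁻¹ − c⁻¹(c̈∕2)c⁻¹)`).
* §3 Bałaban's averaged tower, first-order model (`L ≥ 2`, `d ≥ 1`, `LipschitzBackground V α β`), ALL UNCONDITIONAL: `firstInsertionTower_balaban_bounds` (one-step bound and size of `ċ_k`),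
  `secondInsertionTower_balaban_bounds` (the same for `c̈_k∕2 = (L^d)^k·QB^{(k)}(𝒢P)²𝒢QB^{(k)ᴴ}`, PART 115 order 2), **`effIns2_balaban`** (`c_k⁻¹ċ_kc_k⁻¹ċ_kc_k⁻¹` converges at rate `L^{−k}`),
  **`effInsMixed_balaban`** (two connections `V₁, V₂`: the mixed quintic piece `c_k⁻¹ċ^{(1)}_kc_k⁻¹ċ^{(2)}_kc_k⁻¹` of `V_{bb′}`, rate `L^{−k}`),
  **`effInsSecond_balaban`** (`c_k⁻¹(c̈_k∕2)c_k⁻¹` converges at rate `L^{−k}`) — so by `secondDerivative_tendsto` the second u-derivative `∂_t²Σ_k|₀ = 2·(c_k⁻¹ċ_kc_k⁻¹ċ_kc_k⁻¹ − c_k⁻¹(c̈_k∕2)c_k⁻¹)`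
  of the effective form CONVERGES at rate `L^{−k}` with constant `2(R_A + R_B)`, every input a tree theorem.
WHAT IT DOES NOT DO: the `c_k⁻¹c_{k,st}c_k⁻¹` piece of `V_{bb′}` (PART 118's `effIns_tendsto_of_geom` with PART 119's mixed insertion tower — PART 123 `EffectiveFormMixedInsertionLaw`);
decay; Bałaban's vertices; large couplings.  SUPPLIER work (junction R6 × R7 × NE2);
no consumer of record; NEVER «G-an2-4 closed»; NOT (CONV-C), NOT D1, NOT `BetaPertH`, NOT continuum, NOT Clay.  Records: `HOME/b2b-balaban-gan24-p3/gen51/README.md`.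
-/

noncomputable section

open scoped BigOperators ComplexConjugate Matrix Matrix.Norms.L2Operator
open Filter Topology

namespace Summit.QuantumFields.BalabanUV.Beta.GAN24.EffectiveFormSecondInsertionLaw

open Literature.MathematicalPhysics.QuantumFieldTheory.Balaban1983to89.B5Prop11Plancherel (Cst Cst_nonneg)
open Summit.QuantumFields.BalabanUV.T4Continuum
open Summit.QuantumFields.BalabanUV.T4Continuum.CovariantAveragingTower (avgTow OneStepAveragedLaw)
open Summit.QuantumFields.BalabanUV.T4Continuum.BalabanAveragedTowerUnit (idx QBlev calGlev unitCovB opNorm_QBlev_sq_le oneStepAveragedLaw_QB norm_entry_le_opNorm)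
open Summit.QuantumFields.BalabanUV.T4Continuum.BalabanLineAverage (CQB)
open Summit.QuantumFields.BalabanUV.T4Continuum.KingPairingPlantedLaw (JpcT calDalev calDalev_inv CJ opNorm_inv_calDalev_le)
open Summit.QuantumFields.BalabanUV.T4Continuum.FirstOrderBackgroundModel (LipschitzBackground Pmodel C2model perturbationLaws_firstOrder)
open Summit.QuantumFields.BalabanUV.T4Continuum.BalabanAveragingPairing (freeTowerLaws_balaban)
open Summit.QuantumFields.BalabanUV.T4Continuum.BalabanAveragedCoercive (gammaB gammaB_pos)
open Summit.QuantumFields.BalabanUV.Beta.GAN24.InsertionChainLaw (oneStepAveragedLaw_insertion)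
open Summit.QuantumFields.BalabanUV.Beta.GAN24.EffectiveFormInsertionLaw (opNorm_inv_sub_inv_le effIns_tendsto_of_geom opNorm_avgTow_le opNorm_avgTow_step_le_of_law
  isUnit_det_unitCovB_and_opNorm_inv_le)

/-! ## §1 Five-factor Leibniz -/

section Algebra

variable {ι : Type*} [Fintype ι] [DecidableEq ι]

/-- `‖ABC‖ ≤ abc` from `‖A‖ ≤ a`, `‖B‖ ≤ b`, `‖C‖ ≤ c`. [folklore] -/
theorem opNorm_mul₃_le {A B C : Matrix ι ι ℂ} {a b c : ℝ} (ha : ‖A‖ ≤ a) (hb : ‖B‖ ≤ b) (hc : ‖C‖ ≤ c) : ‖A * B * C‖ ≤ a * b * c := by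
  have ha0 : 0 ≤ a := (norm_nonneg _).trans ha
  have hab : ‖A * B‖ ≤ a * b := (Matrix.l2_opNorm_mul _ _).trans (mul_le_mul ha hb (norm_nonneg _) ha0)
  exact (Matrix.l2_opNorm_mul _ _).trans (mul_le_mul hab hc (norm_nonneg _) ((norm_nonneg _).trans hab))

/-- `‖ABCDE‖ ≤ abcde` from the five letter bounds. [folklore] -/
theorem opNorm_mul₅_le {A B C D E : Matrix ι ι ℂ} {a b c d e : ℝ} (ha : ‖A‖ ≤ a) (hb : ‖B‖ ≤ b) (hc : ‖C‖ ≤ c) (hd : ‖D‖ ≤ d) (he : ‖E‖ ≤ e) :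
    ‖A * B * C * D * E‖ ≤ a * b * c * d * e := by
  have h3 := opNorm_mul₃_le ha hb hc
  have h4 : ‖A * B * C * D‖ ≤ a * b * c * d := (Matrix.l2_opNorm_mul _ _).trans (mul_le_mul h3 hd (norm_nonneg _) ((norm_nonneg _).trans h3))
  exact (Matrix.l2_opNorm_mul _ _).trans (mul_le_mul h4 he (norm_nonneg _) ((norm_nonneg _).trans h4))

omit [DecidableEq ι] in
/-- five-factor Leibniz (EXACT): `G′X′G′Y′G′ − GXGYG = (G′−G)X′G′Y′G′ + G(X′−X)G′Y′G′ + GX(G′−G)Y′G′ + GXG(Y′−Y)G′ + GXGY(G′−G)`. [folklore] -/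
theorem quint_sub_quint_eq (G G' X X' Y Y' : Matrix ι ι ℂ) :
    G' * X' * G' * Y' * G' - G * X * G * Y * G
      = (G' - G) * X' * G' * Y' * G' + G * (X' - X) * G' * Y' * G' + G * X * (G' - G) * Y' * G' + G * X * G * (Y' - Y) * G'
        + G * X * G * Y * (G' - G) := by
  simp only [Matrix.sub_mul, Matrix.mul_sub]
  abel

/-- **`opNorm_quint_sub_le`**: `‖G‖, ‖G′‖ ≤ B`, `‖X‖, ‖X′‖, ‖Y‖, ‖Y′‖ ≤ m`, `‖G′ − G‖ ≤ e`, `‖X′ − X‖ ≤ e′`, `‖Y′ − Y‖ ≤ e″` ⟹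
`‖G′X′G′Y′G′ − GXGYG‖ ≤ 3B²m²e + B³m(e′ + e″)` (two possibly different middles: the MIXED second derivative `V_{bb′}` has `X ≠ Y`). [our proof] -/
theorem opNorm_quint_sub_le {G G' X X' Y Y' : Matrix ι ι ℂ} {B m e e' e'' : ℝ} (hG : ‖G‖ ≤ B) (hG' : ‖G'‖ ≤ B) (hX : ‖X‖ ≤ m) (hX' : ‖X'‖ ≤ m)
    (hY : ‖Y‖ ≤ m) (hY' : ‖Y'‖ ≤ m) (hGG : ‖G' - G‖ ≤ e) (hXX : ‖X' - X‖ ≤ e') (hYY : ‖Y' - Y‖ ≤ e'') :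
    ‖G' * X' * G' * Y' * G' - G * X * G * Y * G‖ ≤ 3 * B ^ 2 * m ^ 2 * e + B ^ 3 * m * (e' + e'') := by
  rw [quint_sub_quint_eq]
  have t1 := opNorm_mul₅_le hGG hX' hG' hY' hG'
  have t2 := opNorm_mul₅_le hG hXX hG' hY' hG'
  have t3 := opNorm_mul₅_le hG hX hGG hY' hG'
  have t4 := opNorm_mul₅_le hG hX hG hYY hG'
  have t5 := opNorm_mul₅_le hG hX hG hY hGG
  calc _ ≤ ‖(G' - G) * X' * G' * Y' * G' + G * (X' - X) * G' * Y' * G' + G * X * (G' - G) * Y' * G' + G * X * G * (Y' - Y) * G'‖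
          + ‖G * X * G * Y * (G' - G)‖ := norm_add_le _ _
    _ ≤ (‖(G' - G) * X' * G' * Y' * G' + G * (X' - X) * G' * Y' * G' + G * X * (G' - G) * Y' * G'‖ + ‖G * X * G * (Y' - Y) * G'‖)
          + ‖G * X * G * Y * (G' - G)‖ := add_le_add (norm_add_le _ _) le_rfl
    _ ≤ ((‖(G' - G) * X' * G' * Y' * G' + G * (X' - X) * G' * Y' * G'‖ + ‖G * X * (G' - G) * Y' * G'‖) + ‖G * X * G * (Y' - Y) * G'‖)
          + ‖G * X * G * Y * (G' - G)‖ := add_le_add (add_le_add (norm_add_le _ _) le_rfl) le_rfl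
    _ ≤ (((‖(G' - G) * X' * G' * Y' * G'‖ + ‖G * (X' - X) * G' * Y' * G'‖) + ‖G * X * (G' - G) * Y' * G'‖) + ‖G * X * G * (Y' - Y) * G'‖)
          + ‖G * X * G * Y * (G' - G)‖ := add_le_add (add_le_add (add_le_add (norm_add_le _ _) le_rfl) le_rfl) le_rfl
    _ ≤ (((e * m * B * m * B + B * e' * B * m * B) + B * m * e * m * B) + B * m * B * e'' * B) + B * m * B * m * e :=
        add_le_add (add_le_add (add_le_add (add_le_add t1 t2) t3) t4) t5
    _ = 3 * B ^ 2 * m ^ 2 * e + B ^ 3 * m * (e' + e'') := by ring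

/-- **`opNorm_effIns2_sub_le` — THE QUINTIC PIECE OF A SECOND u-DERIVATIVE AT TWO LEVELS** [our proof]: `‖c⁻¹‖, ‖c′⁻¹‖ ≤ B`, `‖X‖, ‖X′‖, ‖Y‖, ‖Y′‖ ≤ m`, `‖c′ − c‖ ≤ ε`,
`‖X′ − X‖ ≤ ε′`, `‖Y′ − Y‖ ≤ ε″` ⟹ `‖c′⁻¹X′c′⁻¹Y′c′⁻¹ − c⁻¹Xc⁻¹Yc⁻¹‖ ≤ 3B⁴m²ε + B³m(ε′ + ε″)`. -/
theorem opNorm_effIns2_sub_le {c c' X X' Y Y' : Matrix ι ι ℂ} (hc : IsUnit c.det) (hc' : IsUnit c'.det) {B m ε ε' ε'' : ℝ}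
    (hB : ‖c⁻¹‖ ≤ B) (hB' : ‖c'⁻¹‖ ≤ B) (hX : ‖X‖ ≤ m) (hX' : ‖X'‖ ≤ m) (hY : ‖Y‖ ≤ m) (hY' : ‖Y'‖ ≤ m) (hcc : ‖c' - c‖ ≤ ε)
    (hXX : ‖X' - X‖ ≤ ε') (hYY : ‖Y' - Y‖ ≤ ε'') :
    ‖c'⁻¹ * X' * c'⁻¹ * Y' * c'⁻¹ - c⁻¹ * X * c⁻¹ * Y * c⁻¹‖ ≤ 3 * B ^ 4 * m ^ 2 * ε + B ^ 3 * m * (ε' + ε'') := by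
  have h := opNorm_quint_sub_le hB hB' hX hX' hY hY' ((opNorm_inv_sub_inv_le hc hc' hB hB').trans (mul_le_mul_of_nonneg_left hcc (sq_nonneg B))) hXX hYY
  calc _ ≤ 3 * B ^ 2 * m ^ 2 * (B ^ 2 * ε) + B ^ 3 * m * (ε' + ε'') := h
    _ = 3 * B ^ 4 * m ^ 2 * ε + B ^ 3 * m * (ε' + ε'') := by ring

end Algebra

/-! ## §2 Towers -/

section Tower

variable {ι : Type*} [Fintype ι] [DecidableEq ι] {cc X Y : ℕ → Matrix ι ι ℂ} {B m : ℝ} {ε ε' ε'' : ℕ → ℝ}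

/-- **`opNorm_effIns2_step_le`**: `‖c_k⁻¹‖ ≤ B`, `‖X_k‖, ‖Y_k‖ ≤ m`, one-step bounds `ε_k`, `ε′_k`, `ε″_k` ⟹
`‖c_{k+1}⁻¹X_{k+1}c_{k+1}⁻¹Y_{k+1}c_{k+1}⁻¹ − c_k⁻¹X_kc_k⁻¹Y_kc_k⁻¹‖ ≤ 3B⁴m²ε_k + B³m(ε′_k + ε″_k)`. [our proof] -/
theorem opNorm_effIns2_step_le (hu : ∀ k, IsUnit (cc k).det) (hB : ∀ k, ‖(cc k)⁻¹‖ ≤ B) (hXm : ∀ k, ‖X k‖ ≤ m) (hYm : ∀ k, ‖Y k‖ ≤ m)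
    (hcc : ∀ k, ‖cc (k + 1) - cc k‖ ≤ ε k) (hXX : ∀ k, ‖X (k + 1) - X k‖ ≤ ε' k) (hYY : ∀ k, ‖Y (k + 1) - Y k‖ ≤ ε'' k) (k : ℕ) :
    ‖(cc (k + 1))⁻¹ * X (k + 1) * (cc (k + 1))⁻¹ * Y (k + 1) * (cc (k + 1))⁻¹ - (cc k)⁻¹ * X k * (cc k)⁻¹ * Y k * (cc k)⁻¹‖
      ≤ 3 * B ^ 4 * m ^ 2 * ε k + B ^ 3 * m * (ε' k + ε'' k) :=
  opNorm_effIns2_sub_le (hu k) (hu (k + 1)) (hB k) (hB (k + 1)) (hXm k) (hXm (k + 1)) (hYm k) (hYm (k + 1)) (hcc k) (hXX k) (hYY k)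

/-- the same ENTRYWISE on the unit lattice. [our proof] -/
theorem norm_effIns2_entry_step_le (hu : ∀ k, IsUnit (cc k).det) (hB : ∀ k, ‖(cc k)⁻¹‖ ≤ B) (hXm : ∀ k, ‖X k‖ ≤ m) (hYm : ∀ k, ‖Y k‖ ≤ m)
    (hcc : ∀ k, ‖cc (k + 1) - cc k‖ ≤ ε k) (hXX : ∀ k, ‖X (k + 1) - X k‖ ≤ ε' k) (hYY : ∀ k, ‖Y (k + 1) - Y k‖ ≤ ε'' k) (k : ℕ) (i j : ι) :
    ‖((cc (k + 1))⁻¹ * X (k + 1) * (cc (k + 1))⁻¹ * Y (k + 1) * (cc (k + 1))⁻¹) i j - ((cc k)⁻¹ * X k * (cc k)⁻¹ * Y k * (cc k)⁻¹) i j‖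
      ≤ 3 * B ^ 4 * m ^ 2 * ε k + B ^ 3 * m * (ε' k + ε'' k) := by
  rw [← Matrix.sub_apply]
  exact (norm_entry_le_opNorm _ i j).trans (opNorm_effIns2_step_le hu hB hXm hYm hcc hXX hYY k)

/-- **`effIns2_tendsto_of_geom`**: geometric one-step sizes (`Cρ^k`, `C′ρ^k`, `C″ρ^k`, `ρ < 1`) ⟹ `c_k⁻¹X_kc_k⁻¹Y_kc_k⁻¹` CONVERGES with
`‖· − lim‖ ≤ (3B⁴m²C + B³m(C′ + C″))·ρ^k/(1 − ρ)`. [our proof] -/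
theorem effIns2_tendsto_of_geom (hu : ∀ k, IsUnit (cc k).det) (hB : ∀ k, ‖(cc k)⁻¹‖ ≤ B) (hXm : ∀ k, ‖X k‖ ≤ m) (hYm : ∀ k, ‖Y k‖ ≤ m)
    {C C' C'' ρ : ℝ} (hρ1 : ρ < 1) (hcc : ∀ k, ‖cc (k + 1) - cc k‖ ≤ C * ρ ^ k) (hXX : ∀ k, ‖X (k + 1) - X k‖ ≤ C' * ρ ^ k)
    (hYY : ∀ k, ‖Y (k + 1) - Y k‖ ≤ C'' * ρ ^ k) :
    ∃ Ilim : Matrix ι ι ℂ, Tendsto (fun k => (cc k)⁻¹ * X k * (cc k)⁻¹ * Y k * (cc k)⁻¹) atTop (𝓝 Ilim) ∧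
      ∀ k, ‖(cc k)⁻¹ * X k * (cc k)⁻¹ * Y k * (cc k)⁻¹ - Ilim‖ ≤ (3 * B ^ 4 * m ^ 2 * C + B ^ 3 * m * (C' + C'')) * ρ ^ k / (1 - ρ) := by
  have hstep : ∀ k, dist ((cc k)⁻¹ * X k * (cc k)⁻¹ * Y k * (cc k)⁻¹) ((cc (k + 1))⁻¹ * X (k + 1) * (cc (k + 1))⁻¹ * Y (k + 1) * (cc (k + 1))⁻¹)
      ≤ (3 * B ^ 4 * m ^ 2 * C + B ^ 3 * m * (C' + C'')) * ρ ^ k := by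
    intro k
    rw [dist_eq_norm, ← norm_neg, neg_sub]
    refine (opNorm_effIns2_step_le hu hB hXm hYm hcc hXX hYY k).trans (le_of_eq ?_)
    ring
  have hcs := cauchySeq_of_le_geometric ρ _ hρ1 hstep
  obtain ⟨Ilim, hlim⟩ := cauchySeq_tendsto_of_complete hcs
  exact ⟨Ilim, hlim, fun k => by rw [← dist_eq_norm]; exact dist_le_of_le_geometric_of_tendsto ρ _ hρ1 hstep hlim k⟩

/-- **`secondDerivative_tendsto`** — combining two convergent towers: `‖A_k − A_∞‖ ≤ R_A·ρ^k/(1−ρ)`, `‖B_k − B_∞‖ ≤ R_B·ρ^k/(1−ρ)` ⟹ `2·(A_k − B_k) → 2·(A_∞ − B_∞)` with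
`‖2·(A_k − B_k) − 2·(A_∞ − B_∞)‖ ≤ 2(R_A + R_B)·ρ^k/(1−ρ)` (the shape of `∂_t²(c⁻¹)|₀ = 2c⁻¹ċc⁻¹ċc⁻¹ − c⁻¹c̈c⁻¹ = 2·(c⁻¹ċc⁻¹ċc⁻¹ − c⁻¹(c̈∕2)c⁻¹)`). [our proof] -/
theorem secondDerivative_tendsto {Aseq Bseq : ℕ → Matrix ι ι ℂ} {Ainf Binf : Matrix ι ι ℂ} {RA RB ρ : ℝ}
    (hA : Tendsto Aseq atTop (𝓝 Ainf)) (hB : Tendsto Bseq atTop (𝓝 Binf)) (hAr : ∀ k, ‖Aseq k - Ainf‖ ≤ RA * ρ ^ k / (1 - ρ))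
    (hBr : ∀ k, ‖Bseq k - Binf‖ ≤ RB * ρ ^ k / (1 - ρ)) :
    Tendsto (fun k => (2 : ℂ) • (Aseq k - Bseq k)) atTop (𝓝 ((2 : ℂ) • (Ainf - Binf))) ∧
      ∀ k, ‖(2 : ℂ) • (Aseq k - Bseq k) - (2 : ℂ) • (Ainf - Binf)‖ ≤ 2 * (RA + RB) * ρ ^ k / (1 - ρ) := by
  refine ⟨(hA.sub hB).const_smul (2 : ℂ), fun k => ?_⟩
  have e : (2 : ℂ) • (Aseq k - Bseq k) - (2 : ℂ) • (Ainf - Binf) = (2 : ℂ) • ((Aseq k - Ainf) - (Bseq k - Binf)) := by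
    rw [← smul_sub]; congr 1; abel
  have h2 : ‖(2 : ℂ)‖ = 2 := by simp
  rw [e, norm_smul, h2]
  calc 2 * ‖(Aseq k - Ainf) - (Bseq k - Binf)‖ ≤ 2 * (‖Aseq k - Ainf‖ + ‖Bseq k - Binf‖) := mul_le_mul_of_nonneg_left (norm_sub_le _ _) zero_le_two
    _ ≤ 2 * (RA * ρ ^ k / (1 - ρ) + RB * ρ ^ k / (1 - ρ)) := mul_le_mul_of_nonneg_left (add_le_add (hAr k) (hBr k)) zero_le_two
    _ = 2 * (RA + RB) * ρ ^ k / (1 - ρ) := by ring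

end Tower

/-! ## §3 Bałaban's (1.18)-averaged tower with the first-order model: the second u-derivative of the effective form, unconditionally -/

section Balaban

variable {d : ℕ} (L : ℕ) [NeZero L] (M : Fin d → ℕ) [hM : ∀ μ, NeZero (M μ)] (a : ℝ) (ha : 0 < a)

/-- the FIRST insertion tower `ċ_k = (L^d)^k·QB^{(k)}𝒢P𝒢QB^{(k)ᴴ}` on Bałaban's averaged tower: one-step bound `C₁·L^{−k}` (PART 115 order 1 over `freeTowerLaws_balaban` + `perturbationLaws_firstOrder`)
and size `‖ċ_k‖ ≤ κCst`, `κ = d(α+β)Cst`, `C₁ = 2κCJ + C2model + κ(2dCst + 2dLCst)`. [our proof] -/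
theorem firstInsertionTower_balaban_bounds (hd : 1 ≤ d) {V : (k : ℕ) → Fin d → (idx L M k → ℂ)} {α β : ℝ} (hV : LipschitzBackground L M V α β) :
    (∀ k, ‖avgTow (QBlev L M) ((L : ℝ) ^ d) (fun k => calGlev L M a ha k * Pmodel L M V k * calGlev L M a ha k) (k + 1)
        - avgTow (QBlev L M) ((L : ℝ) ^ d) (fun k => calGlev L M a ha k * Pmodel L M V k * calGlev L M a ha k) k‖
        ≤ ((2 * (d * (α + β) * Cst d a) * CJ d a + C2model d L a α β) + (d * (α + β) * Cst d a) * (2 * d * Cst d a + 2 * (d * L * Cst d a))) * ((L : ℝ)⁻¹) ^ k) ∧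
    (∀ k, ‖avgTow (QBlev L M) ((L : ℝ) ^ d) (fun k => calGlev L M a ha k * Pmodel L M V k * calGlev L M a ha k) k‖ ≤ (d * (α + β) * Cst d a) * Cst d a) := by
  have hr : (0 : ℝ) < (L : ℝ) ^ d := pow_pos (by exact_mod_cast Nat.pos_of_ne_zero (NeZero.ne L)) d
  have hpert := perturbationLaws_firstOrder L M a ha hd hV
  have e : (fun k => ((calDalev L M a ha k)⁻¹ * Pmodel L M V k) ^ 1 * (calDalev L M a ha k)⁻¹)
      = fun k => calGlev L M a ha k * Pmodel L M V k * calGlev L M a ha k := by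
    funext k
    rw [pow_one, calDalev_inv]
  have hlaw := oneStepAveragedLaw_insertion hr (freeTowerLaws_balaban L M a ha) hpert 1
  rw [e] at hlaw
  refine ⟨fun k => ?_, fun k => ?_⟩
  · refine (opNorm_avgTow_step_le_of_law hr (opNorm_QBlev_sq_le L M) hlaw k).trans (le_of_eq ?_)
    simp only [Nat.cast_one, pow_one, Nat.sub_self, pow_zero]
    ring
  · refine (opNorm_avgTow_le hr (opNorm_QBlev_sq_le L M) _ k).trans ?_
    have h1 : ‖calGlev L M a ha k * Pmodel L M V k‖ ≤ d * (α + β) * Cst d a := by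
      rw [← calDalev_inv]; exact hpert.opNorm_inv_mul_P_le k
    have h2 : ‖calGlev L M a ha k‖ ≤ Cst d a := by rw [← calDalev_inv]; exact opNorm_inv_calDalev_le L M a ha k
    exact (Matrix.l2_opNorm_mul _ _).trans (mul_le_mul h1 h2 (norm_nonneg _) ((norm_nonneg _).trans h1))

/-- the SECOND insertion tower `c̈_k∕2 = (L^d)^k·QB^{(k)}(𝒢P)²𝒢QB^{(k)ᴴ}`: one-step bound `C₂′·L^{−k}` (PART 115 order 2) and size `≤ κ²Cst`, `C₂′ = 3κ²CJ + 2κC2model + κ²(2dCst + 2dLCst)`. [our proof] -/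
theorem secondInsertionTower_balaban_bounds (hd : 1 ≤ d) {V : (k : ℕ) → Fin d → (idx L M k → ℂ)} {α β : ℝ} (hV : LipschitzBackground L M V α β) :
    (∀ k, ‖avgTow (QBlev L M) ((L : ℝ) ^ d) (fun k => (calGlev L M a ha k * Pmodel L M V k) ^ 2 * calGlev L M a ha k) (k + 1)
        - avgTow (QBlev L M) ((L : ℝ) ^ d) (fun k => (calGlev L M a ha k * Pmodel L M V k) ^ 2 * calGlev L M a ha k) k‖
        ≤ ((3 * (d * (α + β) * Cst d a) ^ 2 * CJ d a + 2 * (d * (α + β) * Cst d a) * C2model d L a α β)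
            + (d * (α + β) * Cst d a) ^ 2 * (2 * d * Cst d a + 2 * (d * L * Cst d a))) * ((L : ℝ)⁻¹) ^ k) ∧
    (∀ k, ‖avgTow (QBlev L M) ((L : ℝ) ^ d) (fun k => (calGlev L M a ha k * Pmodel L M V k) ^ 2 * calGlev L M a ha k) k‖
        ≤ (d * (α + β) * Cst d a) ^ 2 * Cst d a) := by
  have hr : (0 : ℝ) < (L : ℝ) ^ d := pow_pos (by exact_mod_cast Nat.pos_of_ne_zero (NeZero.ne L)) d
  have hpert := perturbationLaws_firstOrder L M a ha hd hV
  have e : (fun k => ((calDalev L M a ha k)⁻¹ * Pmodel L M V k) ^ 2 * (calDalev L M a ha k)⁻¹)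
      = fun k => (calGlev L M a ha k * Pmodel L M V k) ^ 2 * calGlev L M a ha k := by
    funext k
    rw [calDalev_inv]
  have hlaw := oneStepAveragedLaw_insertion hr (freeTowerLaws_balaban L M a ha) hpert 2
  rw [e] at hlaw
  have e2 : (2 : ℕ) - 1 = 1 := rfl
  refine ⟨fun k => ?_, fun k => ?_⟩
  · refine (opNorm_avgTow_step_le_of_law hr (opNorm_QBlev_sq_le L M) hlaw k).trans (le_of_eq ?_)
    simp only [Nat.cast_ofNat, e2, pow_one]
    ring
  · refine (opNorm_avgTow_le hr (opNorm_QBlev_sq_le L M) _ k).trans ?_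
    have h1 : ‖calGlev L M a ha k * Pmodel L M V k‖ ≤ d * (α + β) * Cst d a := by
      rw [← calDalev_inv]; exact hpert.opNorm_inv_mul_P_le k
    have h2 : ‖calGlev L M a ha k‖ ≤ Cst d a := by rw [← calDalev_inv]; exact opNorm_inv_calDalev_le L M a ha k
    have hκ : 0 ≤ d * (α + β) * Cst d a := (norm_nonneg _).trans h1
    have hsq : ‖(calGlev L M a ha k * Pmodel L M V k) ^ 2‖ ≤ (d * (α + β) * Cst d a) ^ 2 := by
      rw [pow_two, pow_two]
      exact (Matrix.l2_opNorm_mul _ _).trans (mul_le_mul h1 h1 (norm_nonneg _) hκ)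
    exact (Matrix.l2_opNorm_mul _ _).trans (mul_le_mul hsq h2 (norm_nonneg _) (pow_nonneg hκ 2))

/-- **`effIns2_balaban` — THE QUINTIC PIECE `c_k⁻¹ċ_kc_k⁻¹ċ_kc_k⁻¹` CONVERGES AT RATE `L^{−k}`, UNCONDITIONALLY** [our proof] (`L ≥ 2`, `d ≥ 1`, `LipschitzBackground V α β`; `c_k = unitCovB k`,
UB = `uniformCoercive_unitCovB`). -/
theorem effIns2_balaban (hL : 2 ≤ L) (hd : 1 ≤ d) {V : (k : ℕ) → Fin d → (idx L M k → ℂ)} {α β : ℝ} (hV : LipschitzBackground L M V α β) :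
    ∃ Ilim : Matrix (idx L M 0) (idx L M 0) ℂ,
      Tendsto (fun k => (unitCovB L M a ha k)⁻¹ * avgTow (QBlev L M) ((L : ℝ) ^ d) (fun k => calGlev L M a ha k * Pmodel L M V k * calGlev L M a ha k) k
          * (unitCovB L M a ha k)⁻¹ * avgTow (QBlev L M) ((L : ℝ) ^ d) (fun k => calGlev L M a ha k * Pmodel L M V k * calGlev L M a ha k) k
          * (unitCovB L M a ha k)⁻¹) atTop (𝓝 Ilim) ∧
      ∀ k, ‖(unitCovB L M a ha k)⁻¹ * avgTow (QBlev L M) ((L : ℝ) ^ d) (fun k => calGlev L M a ha k * Pmodel L M V k * calGlev L M a ha k) k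
          * (unitCovB L M a ha k)⁻¹ * avgTow (QBlev L M) ((L : ℝ) ^ d) (fun k => calGlev L M a ha k * Pmodel L M V k * calGlev L M a ha k) k
          * (unitCovB L M a ha k)⁻¹ - Ilim‖
        ≤ (3 * ((gammaB d a)⁻¹) ^ 4 * ((d * (α + β) * Cst d a) * Cst d a) ^ 2 * CQB d a
            + 2 * ((gammaB d a)⁻¹) ^ 3 * ((d * (α + β) * Cst d a) * Cst d a)
              * ((2 * (d * (α + β) * Cst d a) * CJ d a + C2model d L a α β) + (d * (α + β) * Cst d a) * (2 * d * Cst d a + 2 * (d * L * Cst d a))))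
          * ((L : ℝ)⁻¹) ^ k / (1 - (L : ℝ)⁻¹) := by
  have hL1 : (1 : ℝ) < L := by exact_mod_cast (lt_of_lt_of_le one_lt_two hL : 1 < L)
  have hr : (0 : ℝ) < (L : ℝ) ^ d := pow_pos (lt_trans zero_lt_one hL1) d
  obtain ⟨hXX, hXm⟩ := firstInsertionTower_balaban_bounds L M a ha hd hV
  have hcc : ∀ k, ‖unitCovB L M a ha (k + 1) - unitCovB L M a ha k‖ ≤ CQB d a * ((L : ℝ)⁻¹) ^ k := fun k =>
    opNorm_avgTow_step_le_of_law hr (opNorm_QBlev_sq_le L M) (oneStepAveragedLaw_QB L M a ha) k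
  have h := effIns2_tendsto_of_geom (cc := unitCovB L M a ha) (fun k => (isUnit_det_unitCovB_and_opNorm_inv_le L M a ha k).1)
    (fun k => (isUnit_det_unitCovB_and_opNorm_inv_le L M a ha k).2) hXm hXm (inv_lt_one_of_one_lt₀ hL1) hcc hXX hXX
  obtain ⟨Ilim, hlim, hrate⟩ := h
  exact ⟨Ilim, hlim, fun k => (hrate k).trans (le_of_eq (by ring))⟩

/-- **`effInsMixed_balaban` — THE MIXED QUINTIC PIECE `c_k⁻¹ċ^{(1)}_kc_k⁻¹ċ^{(2)}_kc_k⁻¹` (two Lipschitz connections `V₁, V₂`; the `V_{bb′}` class) CONVERGES AT RATE `L^{−k}`,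
UNCONDITIONALLY** [our proof] (`L ≥ 2`, `d ≥ 1`, `LipschitzBackground V_i α β` with common `(α, β)`). -/
theorem effInsMixed_balaban (hL : 2 ≤ L) (hd : 1 ≤ d) {V₁ V₂ : (k : ℕ) → Fin d → (idx L M k → ℂ)} {α β : ℝ} (hV₁ : LipschitzBackground L M V₁ α β)
    (hV₂ : LipschitzBackground L M V₂ α β) :
    ∃ Ilim : Matrix (idx L M 0) (idx L M 0) ℂ,
      Tendsto (fun k => (unitCovB L M a ha k)⁻¹ * avgTow (QBlev L M) ((L : ℝ) ^ d) (fun k => calGlev L M a ha k * Pmodel L M V₁ k * calGlev L M a ha k) k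
          * (unitCovB L M a ha k)⁻¹ * avgTow (QBlev L M) ((L : ℝ) ^ d) (fun k => calGlev L M a ha k * Pmodel L M V₂ k * calGlev L M a ha k) k
          * (unitCovB L M a ha k)⁻¹) atTop (𝓝 Ilim) ∧
      ∀ k, ‖(unitCovB L M a ha k)⁻¹ * avgTow (QBlev L M) ((L : ℝ) ^ d) (fun k => calGlev L M a ha k * Pmodel L M V₁ k * calGlev L M a ha k) k
          * (unitCovB L M a ha k)⁻¹ * avgTow (QBlev L M) ((L : ℝ) ^ d) (fun k => calGlev L M a ha k * Pmodel L M V₂ k * calGlev L M a ha k) k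
          * (unitCovB L M a ha k)⁻¹ - Ilim‖
        ≤ (3 * ((gammaB d a)⁻¹) ^ 4 * ((d * (α + β) * Cst d a) * Cst d a) ^ 2 * CQB d a
            + ((gammaB d a)⁻¹) ^ 3 * ((d * (α + β) * Cst d a) * Cst d a)
              * (2 * ((2 * (d * (α + β) * Cst d a) * CJ d a + C2model d L a α β) + (d * (α + β) * Cst d a) * (2 * d * Cst d a + 2 * (d * L * Cst d a)))))
          * ((L : ℝ)⁻¹) ^ k / (1 - (L : ℝ)⁻¹) := by
  have hL1 : (1 : ℝ) < L := by exact_mod_cast (lt_of_lt_of_le one_lt_two hL : 1 < L)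
  have hr : (0 : ℝ) < (L : ℝ) ^ d := pow_pos (lt_trans zero_lt_one hL1) d
  obtain ⟨hXX, hXm⟩ := firstInsertionTower_balaban_bounds L M a ha hd hV₁
  obtain ⟨hYY, hYm⟩ := firstInsertionTower_balaban_bounds L M a ha hd hV₂
  have hcc : ∀ k, ‖unitCovB L M a ha (k + 1) - unitCovB L M a ha k‖ ≤ CQB d a * ((L : ℝ)⁻¹) ^ k := fun k =>
    opNorm_avgTow_step_le_of_law hr (opNorm_QBlev_sq_le L M) (oneStepAveragedLaw_QB L M a ha) k
  have h := effIns2_tendsto_of_geom (cc := unitCovB L M a ha) (fun k => (isUnit_det_unitCovB_and_opNorm_inv_le L M a ha k).1)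
    (fun k => (isUnit_det_unitCovB_and_opNorm_inv_le L M a ha k).2) hXm hYm (inv_lt_one_of_one_lt₀ hL1) hcc hXX hYY
  obtain ⟨Ilim, hlim, hrate⟩ := h
  exact ⟨Ilim, hlim, fun k => (hrate k).trans (le_of_eq (by ring))⟩

/-- **`effInsSecond_balaban` — THE PIECE `c_k⁻¹(c̈_k∕2)c_k⁻¹` CONVERGES AT RATE `L^{−k}`, UNCONDITIONALLY** [our proof] (PART 118's `effIns_tendsto_of_geom` with the order-2 insertion tower). -/
theorem effInsSecond_balaban (hL : 2 ≤ L) (hd : 1 ≤ d) {V : (k : ℕ) → Fin d → (idx L M k → ℂ)} {α β : ℝ} (hV : LipschitzBackground L M V α β) :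
    ∃ Ilim : Matrix (idx L M 0) (idx L M 0) ℂ,
      Tendsto (fun k => (unitCovB L M a ha k)⁻¹ * avgTow (QBlev L M) ((L : ℝ) ^ d) (fun k => (calGlev L M a ha k * Pmodel L M V k) ^ 2 * calGlev L M a ha k) k
          * (unitCovB L M a ha k)⁻¹) atTop (𝓝 Ilim) ∧
      ∀ k, ‖(unitCovB L M a ha k)⁻¹ * avgTow (QBlev L M) ((L : ℝ) ^ d) (fun k => (calGlev L M a ha k * Pmodel L M V k) ^ 2 * calGlev L M a ha k) k
          * (unitCovB L M a ha k)⁻¹ - Ilim‖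
        ≤ (((gammaB d a)⁻¹) ^ 2 * ((3 * (d * (α + β) * Cst d a) ^ 2 * CJ d a + 2 * (d * (α + β) * Cst d a) * C2model d L a α β)
              + (d * (α + β) * Cst d a) ^ 2 * (2 * d * Cst d a + 2 * (d * L * Cst d a)))
            + 2 * ((gammaB d a)⁻¹) ^ 3 * ((d * (α + β) * Cst d a) ^ 2 * Cst d a) * CQB d a) * ((L : ℝ)⁻¹) ^ k / (1 - (L : ℝ)⁻¹) := by
  have hL1 : (1 : ℝ) < L := by exact_mod_cast (lt_of_lt_of_le one_lt_two hL : 1 < L)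
  have hr : (0 : ℝ) < (L : ℝ) ^ d := pow_pos (lt_trans zero_lt_one hL1) d
  obtain ⟨hXX, hXm⟩ := secondInsertionTower_balaban_bounds L M a ha hd hV
  have hcc : ∀ k, ‖unitCovB L M a ha (k + 1) - unitCovB L M a ha k‖ ≤ CQB d a * ((L : ℝ)⁻¹) ^ k := fun k =>
    opNorm_avgTow_step_le_of_law hr (opNorm_QBlev_sq_le L M) (oneStepAveragedLaw_QB L M a ha) k
  exact effIns_tendsto_of_geom (cc := unitCovB L M a ha) (fun k => (isUnit_det_unitCovB_and_opNorm_inv_le L M a ha k).1)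
    (fun k => (isUnit_det_unitCovB_and_opNorm_inv_le L M a ha k).2) hXm (inv_lt_one_of_one_lt₀ hL1) hcc hXX

end Balaban

end Summit.QuantumFields.BalabanUV.Beta.GAN24.EffectiveFormSecondInsertionLaw

end
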